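import Summits.QuantumFields.BalabanUV.Beta.GAN24.SandwichReadoutSiteCharges

/-!
# `BalabanUV.Beta.GAN24.SandwichReadoutWeighted` — binder row G-an2-4 ∕ (CONV-C), conservation law (C) AT LEVELS `j ≥ 1`, CONTACT side, the (γ) hand's «DEPTH TOWER»
# (memo `HOME/b2b-balaban-gan24-formalise-leaf-06/g54/C-LEVELS-GE1-g54.md` §29–§30, letter K6a): **THE SANDWICH ∕ EXCHANGE ∕ `K3OfK` READ-OUTS WITH WEIGHTED
# COARSE LEGS** — leaf-04's `SandwichReadoutSiteCharges` (site-dependent charges `ρL f y`, `ρR g w`) VERBATIM with bounded WEIGHTS `φ x′`, `ψ z′` on the two coarse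
# legs of the summand: `Σ'_{(x′,z′)} φ x′·ψ z′·(K∘V∘K)(N•x′, N•z′)_{(inr α, inr β)} = Σ'_{(y,w)} Σ_{f,g} ρL f y·V y w f g·ρR g w` whenever the WEIGHTED coarse-leg sums
# of `K` have the charges `ρL ∕ ρR` (`hasSum_sandwich_readout_weight`, `hasSum_exchange_readout_weight`, `hasSum_mmRead_K3OfK_weight`).

NOT IN PRINT; OUR BOOKKEEPING ([folklore] dominated Fubini over absolutely convergent lattice sums — this lineage's gen-8 `ResolventLegCharges.hasSum_sandwich_readout`
proof, re-run by leaf-04 g65 with two-argument charges, re-run here with bounded leg weights (the majorant picks up `Bφ·Bψ`, nothing else changes); G-an2-4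
formalisation swarm, leaf prover `b2b-balaban-gan24-formalise-leaf-06`, gen 54).  HONEST FRAMING (cell contract, verbatim): «discharging `BetaPertH` makes Bałaban's UV
stability UNCONDITIONAL — a real constructive-QFT result; it is NOT the continuum limit and NOT the Clay problem.»  HONEST DEPENDENCY (verbatim): «continuum YM on T⁴ ⇐
BetaPertH ∧ nine spine estimates (0/9 proved); BetaPertH ⇐ (D1) ∧ (D4) ∧ CAP+tail; G-an2-4 gates asym, D1 and NE2/3/4.»

WHY (memo §30): the FOUR-FACE reading of road-P2's member (`T2RecChargeStepFourFace.zmode_succ_eq_fourFace`; leaf-02 Part 39 `FourFaceDressedZeroMode`) restricts the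
member's legs — which ARE the lower level's MULTIPLIER legs at the dilated points (`BalabanStepJetsSucc.mmRead_inl_inl`) — to exit faces: the coarse legs of leaf-04's
read-out (E0) `DressedStepFaceCharges.hasSum_mmRead_K3OfK_dressedStep` acquire the weights `φ x′ = [x′_α % Lc = Lc − 1]`, `ψ z′ = [z′_β % Lc = Lc − 1]`.  On the field legs the
weighted charges are this lineage's K1a `DressedVertexFaceBondSum.hasSum_dressedStep_col_coordWeight` (exit faces of the DEEP class `Lc²`); on the multiplier legs they are
face-coset partial sums of the zero-mass block `wΦ` (`MultiplierZeroMass`), which do NOT vanish — this file keeps all charges as hypotheses, so both enter on the same footing.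

WHAT ([folklore]; generic `d`, blocking `N ≥ 1`, decaying `K`, localised `P Q V W dM`, bounded weights; 0 `def`, 0 cited facts, 0 `def … : Prop`, 0 sorry):
§1 `summable_legs_prod_weight`, **`hasSum_sandwich_readout_weight`**; §2 **`hasSum_exchange_readout_weight`**, **`hasSum_mmRead_K3OfK_weight`** (the ff block of
`mmRead N (K3OfK K N S M W b b′)` against `φ ⊗ ψ` = `R[(dM_b∘K)∘dM_{b′}] + R[(dM_{b′}∘K)∘dM_b] − R[W_{bb′}]`, `R[V] := Σ'_{(y,w)} Σ_{f,g} ρL f y·V y w f g·ρR g w`).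
Asserts NO value of Bałaban's tables; discharges NOTHING of (C) ∕ (C)sym ∕ (Q-D); NEVER «G-an2-4 closed» as (CONV-C); NOT D1, NOT `BetaPertH`, NOT continuum, NOT Clay.
2026-08-24; no existing file touched.
-/

noncomputable section

open Finset
open scoped BigOperators
open Literature.MathematicalPhysics.QuantumFieldTheory
open Literature.MathematicalPhysics.QuantumFieldTheory.Balaban1983to89
open Literature.MathematicalPhysics.QuantumFieldTheory.Balaban1983to89.Beta
open B12Sec2to5 (l1 l1_nonneg)
open ExpKernelCalculus (Site MKer BiLoc Decays VertexFamily comp Zl Zl_nonneg summable_exp_shift summable_exp_shift')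
open OneStepResolventKernel (Fib LocStencil)
open SecondOrderResponse (dM K2OfK)
open BalabanStepW2 (K3OfK)
open BalabanStepJetsSucc (mmRead mmRead_inl_inl)
open Summit.QuantumFields.BalabanUV.Beta.TameKernelCalculus (Spr Loc Tame)
open Summit.QuantumFields.BalabanUV.Beta.GAN24.KernelLegCharges (summable_exp_coarse)
open Summit.QuantumFields.BalabanUV.Beta.GAN24.ResolventLegCharges (tsum_exp_coarse_le tsum_exp_coarse_le' summable_exp_coarse' summable_legs_prod)
open Summit.QuantumFields.BalabanUV.Beta.GAN24.ExchangeReadout (exchange_eq_sandwich K3OfK_apply_eq)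

namespace Summit.QuantumFields.BalabanUV.Beta.GAN24.SandwichReadoutWeighted

variable {d : ℕ} {N : ℕ} [NeZero N]

/-! ## §1 The sandwich read-out Fubini with weighted coarse legs -/

/-- [folklore] The weighted two-leg product family `(x′,z′) ↦ φ x′·K(N•x′, y)_{a f}·(ψ z′·K(w, N•z′)_{g b})` of a decaying kernel is summable (bounded weights). -/
theorem summable_legs_prod_weight {K : MKer (d + 1) (Fib d)} {C δ : ℝ} (hK : Decays K C δ) (hδ : 0 < δ) {φ ψ : Site (d + 1) → ℝ} {Bφ Bψ : ℝ}
    (hφ : ∀ x', |φ x'| ≤ Bφ) (hψ : ∀ z', |ψ z'| ≤ Bψ) (y w : Site (d + 1)) (a b f g : Fib d) :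
    Summable fun xz : Site (d + 1) × Site (d + 1) => (φ xz.1 * K ((N : ℤ) • xz.1) y a f) * (ψ xz.2 * K w ((N : ℤ) • xz.2) g b) := by
  have h := summable_legs_prod (N := N) hK hδ y w a b f g
  refine Summable.of_norm_bounded ((h.abs).mul_left (Bφ * Bψ)) (fun xz => ?_)
  rw [Real.norm_eq_abs]
  rw [show (φ xz.1 * K ((N : ℤ) • xz.1) y a f) * (ψ xz.2 * K w ((N : ℤ) • xz.2) g b)
      = (φ xz.1 * ψ xz.2) * (K ((N : ℤ) • xz.1) y a f * K w ((N : ℤ) • xz.2) g b) by ring, abs_mul, abs_mul]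
  exact mul_le_mul_of_nonneg_right (mul_le_mul (hφ xz.1) (hψ xz.2) (abs_nonneg _) ((abs_nonneg _).trans (hφ xz.1))) (abs_nonneg _)

/-- [folklore] **THE SANDWICH READ-OUT FUBINI, WEIGHTED COARSE LEGS**: for a decaying `K`, a bi-localised `V` and bounded leg weights `φ`, `ψ`, if the WEIGHTED coarse
sums of `K`'s multiplier rows ∕ columns have the site-dependent charges `ρL f y` ∕ `ρR g w`, then
`Σ'_{(x′,z′)} φ x′·ψ z′·(K∘V∘K)(N•x′, N•z′)_{(inr α, inr β)}` has the `HasSum` `Σ'_{(y,w)} Σ_{f,g} ρL f y · V y w f g · ρR g w`. -/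
theorem hasSum_sandwich_readout_weight {K V : MKer (d + 1) (Fib d)} {C δ Cv δv : ℝ} {p q : Site (d + 1)} (hK : Decays K C δ) (hδ : 0 < δ)
    (hV : BiLoc V p q Cv δv) (hδv : 0 < δv) (α β : Fin (d + 1)) {φ ψ : Site (d + 1) → ℝ} {Bφ Bψ : ℝ} (hφ : ∀ x', |φ x'| ≤ Bφ) (hψ : ∀ z', |ψ z'| ≤ Bψ)
    {ρL ρR : Fib d → Site (d + 1) → ℝ}
    (hrow : ∀ f y, HasSum (fun x' : Site (d + 1) => φ x' * K ((N : ℤ) • x') y (Sum.inr α) f) (ρL f y))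
    (hcol : ∀ g w, HasSum (fun z' : Site (d + 1) => ψ z' * K w ((N : ℤ) • z') g (Sum.inr β)) (ρR g w)) :
    HasSum (fun xz : Site (d + 1) × Site (d + 1) => φ xz.1 * ψ xz.2 * comp (comp K V) K ((N : ℤ) • xz.1) ((N : ℤ) • xz.2) (Sum.inr α) (Sum.inr β))
      (∑' yw : Site (d + 1) × Site (d + 1), ∑ f, ∑ g, ρL f yw.1 * V yw.1 yw.2 f g * ρR g yw.2) := by
  classical
  have hN : 1 ≤ N := Nat.one_le_iff_ne_zero.2 (NeZero.ne N)
  have hC : 0 ≤ C := hK.nonneg (Sum.inl 0)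
  have hCv : 0 ≤ Cv := hV.nonneg (Sum.inl 0)
  have hBφ : 0 ≤ Bφ := (abs_nonneg _).trans (hφ 0)
  have hBψ : 0 ≤ Bψ := (abs_nonneg _).trans (hψ 0)
  set cF : ℝ := ((Fintype.card (Fib d) : ℕ) : ℝ) with hcF
  -- the weighted four-leg family, outer index `(y, w)`, inner index `(x′, z′)`
  set Φ : Site (d + 1) × Site (d + 1) → Site (d + 1) × Site (d + 1) → ℝ := fun yw xz =>
    ∑ f, ∑ g, (φ xz.1 * K ((N : ℤ) • xz.1) yw.1 (Sum.inr α) f) * V yw.1 yw.2 f g * (ψ xz.2 * K yw.2 ((N : ℤ) • xz.2) g (Sum.inr β)) with hΦ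
  -- the majorant and its sums
  set U : ℝ := Real.exp (δ * ((N : ℝ) * (d + 1))) * Zl (d + 1) δ with hU
  set M : Site (d + 1) × Site (d + 1) → Site (d + 1) × Site (d + 1) → ℝ := fun yw xz =>
    (cF * cF * (Bφ * C * Cv * (Bψ * C)) * Real.exp (-δv * (l1 (yw.1 - p) + l1 (yw.2 - q)))) *
      (Real.exp (-δ * l1 ((N : ℤ) • xz.1 - yw.1)) * Real.exp (-δ * l1 (yw.2 - (N : ℤ) • xz.2))) with hM
  have hM0 : ∀ yw xz, 0 ≤ M yw xz := fun yw xz => by positivity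
  have hΦM : ∀ yw xz, |Φ yw xz| ≤ M yw xz := by
    intro yw xz
    have hterm : ∀ f g, |(φ xz.1 * K ((N : ℤ) • xz.1) yw.1 (Sum.inr α) f) * V yw.1 yw.2 f g * (ψ xz.2 * K yw.2 ((N : ℤ) • xz.2) g (Sum.inr β))| ≤
        (Bφ * (C * Real.exp (-δ * l1 ((N : ℤ) • xz.1 - yw.1)))) * (Cv * Real.exp (-δv * (l1 (yw.1 - p) + l1 (yw.2 - q)))) *
          (Bψ * (C * Real.exp (-δ * l1 (yw.2 - (N : ℤ) • xz.2)))) := by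
      intro f g
      rw [abs_mul, abs_mul, abs_mul, abs_mul]
      have e1 := hK ((N : ℤ) • xz.1) yw.1 (Sum.inr α) f
      have e2 := hV yw.1 yw.2 f g
      have e3 := hK yw.2 ((N : ℤ) • xz.2) g (Sum.inr β)
      have e1' : |φ xz.1| * |K ((N : ℤ) • xz.1) yw.1 (Sum.inr α) f| ≤ Bφ * (C * Real.exp (-δ * l1 ((N : ℤ) • xz.1 - yw.1))) :=
        mul_le_mul (hφ _) e1 (abs_nonneg _) hBφ
      have e3' : |ψ xz.2| * |K yw.2 ((N : ℤ) • xz.2) g (Sum.inr β)| ≤ Bψ * (C * Real.exp (-δ * l1 (yw.2 - (N : ℤ) • xz.2))) :=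
        mul_le_mul (hψ _) e3 (abs_nonneg _) hBψ
      have h0 : 0 ≤ |φ xz.1| * |K ((N : ℤ) • xz.1) yw.1 (Sum.inr α) f| := by positivity
      exact mul_le_mul (mul_le_mul e1' e2 (abs_nonneg _) (h0.trans e1')) e3' (by positivity) (mul_nonneg (h0.trans e1') ((abs_nonneg _).trans e2))
    calc |Φ yw xz| ≤ ∑ f, ∑ g, |(φ xz.1 * K ((N : ℤ) • xz.1) yw.1 (Sum.inr α) f) * V yw.1 yw.2 f g * (ψ xz.2 * K yw.2 ((N : ℤ) • xz.2) g (Sum.inr β))| :=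
          (Finset.abs_sum_le_sum_abs _ _).trans (Finset.sum_le_sum fun f _ => Finset.abs_sum_le_sum_abs _ _)
      _ ≤ ∑ _f : Fib d, ∑ _g : Fib d, (Bφ * (C * Real.exp (-δ * l1 ((N : ℤ) • xz.1 - yw.1)))) *
            (Cv * Real.exp (-δv * (l1 (yw.1 - p) + l1 (yw.2 - q)))) * (Bψ * (C * Real.exp (-δ * l1 (yw.2 - (N : ℤ) • xz.2)))) :=
          Finset.sum_le_sum fun f _ => Finset.sum_le_sum fun g _ => hterm f g
      _ = M yw xz := by
          simp only [Finset.sum_const, Finset.card_univ, nsmul_eq_mul, hM, hcF]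
          ring
  -- inner sums of the majorant
  have hMin : ∀ yw, HasSum (fun xz => M yw xz)
      ((cF * cF * (Bφ * C * Cv * (Bψ * C)) * Real.exp (-δv * (l1 (yw.1 - p) + l1 (yw.2 - q)))) *
        ((∑' x' : Site (d + 1), Real.exp (-δ * l1 ((N : ℤ) • x' - yw.1))) *
          ∑' z' : Site (d + 1), Real.exp (-δ * l1 (yw.2 - (N : ℤ) • z')))) := by
    intro yw
    have h1 := summable_exp_coarse (d := d) hN hδ yw.1
    have h2 := summable_exp_coarse' (d := d) hN hδ yw.2
    have h12 := h1.hasSum.mul h2.hasSum (h1.mul_of_nonneg h2 (fun _ => (Real.exp_pos _).le) (fun _ => (Real.exp_pos _).le))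
    exact h12.mul_left _
  have hMs : Summable (Function.uncurry M) := by
    refine (summable_prod_of_nonneg (fun s => hM0 s.1 s.2)).2 ⟨fun yw => (hMin yw).summable, ?_⟩
    have hbound : ∀ yw : Site (d + 1) × Site (d + 1), ∑' xz, M yw xz ≤
        (cF * cF * (Bφ * C * Cv * (Bψ * C)) * (U * U)) * (Real.exp (-δv * l1 (yw.1 - p)) * Real.exp (-δv * l1 (yw.2 - q))) := by
      intro yw
      rw [(hMin yw).tsum_eq, mul_add, Real.exp_add]
      have hA := tsum_exp_coarse_le (d := d) N hδ yw.1
      have hB := tsum_exp_coarse_le' (d := d) N hδ yw.2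
      have hA0 : 0 ≤ ∑' x' : Site (d + 1), Real.exp (-δ * l1 ((N : ℤ) • x' - yw.1)) := tsum_nonneg fun _ => (Real.exp_pos _).le
      have hB0 : 0 ≤ ∑' z' : Site (d + 1), Real.exp (-δ * l1 (yw.2 - (N : ℤ) • z')) := tsum_nonneg fun _ => (Real.exp_pos _).le
      have hU0 : 0 ≤ U := mul_nonneg (Real.exp_pos _).le (Zl_nonneg hδ)
      have hAB := mul_le_mul hA hB hB0 hU0
      have hc0 : 0 ≤ cF * cF * (Bφ * C * Cv * (Bψ * C)) * (Real.exp (-δv * l1 (yw.1 - p)) * Real.exp (-δv * l1 (yw.2 - q))) := by positivity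
      calc cF * cF * (Bφ * C * Cv * (Bψ * C)) * (Real.exp (-δv * l1 (yw.1 - p)) * Real.exp (-δv * l1 (yw.2 - q))) *
            ((∑' x' : Site (d + 1), Real.exp (-δ * l1 ((N : ℤ) • x' - yw.1))) * ∑' z' : Site (d + 1), Real.exp (-δ * l1 (yw.2 - (N : ℤ) • z')))
          ≤ cF * cF * (Bφ * C * Cv * (Bψ * C)) * (Real.exp (-δv * l1 (yw.1 - p)) * Real.exp (-δv * l1 (yw.2 - q))) * (U * U) :=
            mul_le_mul_of_nonneg_left hAB hc0
        _ = _ := by ring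
    have hsum : Summable fun yw : Site (d + 1) × Site (d + 1) =>
        (cF * cF * (Bφ * C * Cv * (Bψ * C)) * (U * U)) * (Real.exp (-δv * l1 (yw.1 - p)) * Real.exp (-δv * l1 (yw.2 - q))) :=
      ((summable_exp_shift' hδv p).mul_of_nonneg (summable_exp_shift' hδv q) (fun _ => (Real.exp_pos _).le)
        (fun _ => (Real.exp_pos _).le)).mul_left _
    exact Summable.of_nonneg_of_le (fun yw => tsum_nonneg fun xz => hM0 yw xz) hbound hsum
  -- (A) absolute summability of the weighted four-leg family
  have hΦs : Summable (Function.uncurry Φ) :=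
    Summable.of_norm_bounded hMs (fun s => by rw [Real.norm_eq_abs]; exact hΦM s.1 s.2)
  -- (C) the inner sums: only the weighted charges survive
  have hΦin : ∀ yw : Site (d + 1) × Site (d + 1), HasSum (fun xz => Φ yw xz) (∑ f, ∑ g, ρL f yw.1 * V yw.1 yw.2 f g * ρR g yw.2) := by
    intro yw
    refine hasSum_sum fun f _ => hasSum_sum fun g _ => ?_
    have hmul := ((hrow f yw.1).mul (hcol g yw.2) (summable_legs_prod_weight (N := N) hK hδ hφ hψ yw.1 yw.2 _ _ f g)).mul_left (V yw.1 yw.2 f g)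
    rw [show V yw.1 yw.2 f g * (ρL f yw.1 * ρR g yw.2) = ρL f yw.1 * V yw.1 yw.2 f g * ρR g yw.2 by ring] at hmul
    exact hmul.congr_fun fun xz => by ring
  -- (B) the pointwise identity: the weighted nested composition IS the `(y, w)`-sum of `Φ`
  have hΦyw : ∀ xz : Site (d + 1) × Site (d + 1), Summable fun yw : Site (d + 1) × Site (d + 1) => Φ yw xz :=
    fun xz => hΦs.prod_symm.prod_factor xz
  have hpoint : ∀ xz : Site (d + 1) × Site (d + 1),
      φ xz.1 * ψ xz.2 * comp (comp K V) K ((N : ℤ) • xz.1) ((N : ℤ) • xz.2) (Sum.inr α) (Sum.inr β) = ∑' yw : Site (d + 1) × Site (d + 1), Φ yw xz := by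
    intro xz
    -- the unweighted family at this `xz`, and its relation to `Φ`
    set Φ₀ : Site (d + 1) × Site (d + 1) → ℝ := fun yw =>
      ∑ f, ∑ g, K ((N : ℤ) • xz.1) yw.1 (Sum.inr α) f * V yw.1 yw.2 f g * K yw.2 ((N : ℤ) • xz.2) g (Sum.inr β) with hΦ₀
    have hΦΦ₀ : ∀ yw, Φ yw xz = (φ xz.1 * ψ xz.2) * Φ₀ yw := by
      intro yw
      simp only [hΦ, hΦ₀, Finset.mul_sum]
      refine Finset.sum_congr rfl fun f _ => Finset.sum_congr rfl fun g _ => ?_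
      ring
    -- summability of the `(w, y)`-ordered unweighted family's `y`-slices with one fibre index fixed
    have hslice : ∀ (w : Site (d + 1)) (g : Fib d), Summable fun y : Site (d + 1) =>
        ∑ f, K ((N : ℤ) • xz.1) y (Sum.inr α) f * V y w f g * K w ((N : ℤ) • xz.2) g (Sum.inr β) := by
      intro w g
      have hmaj : Summable fun y : Site (d + 1) => (cF * (C * Cv * (C * Real.exp (-δ * l1 (w - (N : ℤ) • xz.2))))) *
          Real.exp (-δ * l1 ((N : ℤ) • xz.1 - y)) := (summable_exp_shift hδ _).mul_left _
      refine Summable.of_norm_bounded hmaj (fun y => ?_)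
      rw [Real.norm_eq_abs]
      have hterm : ∀ f, |K ((N : ℤ) • xz.1) y (Sum.inr α) f * V y w f g * K w ((N : ℤ) • xz.2) g (Sum.inr β)| ≤
          (C * Real.exp (-δ * l1 ((N : ℤ) • xz.1 - y))) * Cv * (C * Real.exp (-δ * l1 (w - (N : ℤ) • xz.2))) := by
        intro f
        rw [abs_mul, abs_mul]
        have e1 := hK ((N : ℤ) • xz.1) y (Sum.inr α) f
        have e2 : |V y w f g| ≤ Cv := by
          refine (hV y w f g).trans ?_
          have : Real.exp (-δv * (l1 (y - p) + l1 (w - q))) ≤ 1 :=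
            Real.exp_le_one_iff.2 (by nlinarith [l1_nonneg (y - p), l1_nonneg (w - q)])
          nlinarith
        have e3 := hK w ((N : ℤ) • xz.2) g (Sum.inr β)
        exact mul_le_mul (mul_le_mul e1 e2 (abs_nonneg _) ((abs_nonneg _).trans e1)) e3 (abs_nonneg _)
          (mul_nonneg ((abs_nonneg _).trans e1) ((abs_nonneg _).trans e2))
      calc |∑ f, K ((N : ℤ) • xz.1) y (Sum.inr α) f * V y w f g * K w ((N : ℤ) • xz.2) g (Sum.inr β)|
          ≤ ∑ f, |K ((N : ℤ) • xz.1) y (Sum.inr α) f * V y w f g * K w ((N : ℤ) • xz.2) g (Sum.inr β)| := Finset.abs_sum_le_sum_abs _ _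
        _ ≤ ∑ _f : Fib d, (C * Real.exp (-δ * l1 ((N : ℤ) • xz.1 - y))) * Cv * (C * Real.exp (-δ * l1 (w - (N : ℤ) • xz.2))) :=
            Finset.sum_le_sum fun f _ => hterm f
        _ = _ := by simp only [Finset.sum_const, Finset.card_univ, nsmul_eq_mul, hcF]; ring
    -- the unweighted `(y,w)` family is summable (from the weighted one when the weights are non-zero, and trivially otherwise we do not need it):
    -- we argue directly with the `(w, y)`-iterated sums
    have hwy : Summable fun wy : Site (d + 1) × Site (d + 1) => Φ (wy.2, wy.1) xz :=
      (Equiv.prodComm (Site (d + 1)) (Site (d + 1))).summable_iff.2 (hΦyw xz) |>.congr fun wy => rfl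
    -- rewrite the nested composition
    have hinner : ∀ w : Site (d + 1), ∑ g, comp K V ((N : ℤ) • xz.1) w (Sum.inr α) g * K w ((N : ℤ) • xz.2) g (Sum.inr β)
        = ∑' y : Site (d + 1), Φ₀ (y, w) := by
      intro w
      have e1 : ∀ g, comp K V ((N : ℤ) • xz.1) w (Sum.inr α) g * K w ((N : ℤ) • xz.2) g (Sum.inr β)
          = ∑' y : Site (d + 1), ∑ f, K ((N : ℤ) • xz.1) y (Sum.inr α) f * V y w f g * K w ((N : ℤ) • xz.2) g (Sum.inr β) := by
        intro g
        simp only [comp]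
        rw [← tsum_mul_right]
        exact tsum_congr fun y => by rw [Finset.sum_mul]
      simp_rw [e1]
      rw [(Summable.tsum_finsetSum fun g _ => hslice w g).symm]
      exact tsum_congr fun y => Finset.sum_comm
    -- the `w`-family `w ↦ Σ'_y Φ₀ (y, w)` : its weighted version is summable with the right sum
    have hcomp : comp (comp K V) K ((N : ℤ) • xz.1) ((N : ℤ) • xz.2) (Sum.inr α) (Sum.inr β) = ∑' w : Site (d + 1), ∑' y : Site (d + 1), Φ₀ (y, w) := by
      simp only [comp] at hinner ⊢
      exact tsum_congr fun w => hinner w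
    calc φ xz.1 * ψ xz.2 * comp (comp K V) K ((N : ℤ) • xz.1) ((N : ℤ) • xz.2) (Sum.inr α) (Sum.inr β)
        = ∑' w : Site (d + 1), ∑' y : Site (d + 1), (φ xz.1 * ψ xz.2) * Φ₀ (y, w) := by
          rw [hcomp, ← tsum_mul_left]
          exact tsum_congr fun w => (tsum_mul_left).symm
      _ = ∑' w : Site (d + 1), ∑' y : Site (d + 1), Φ (y, w) xz := by
          refine tsum_congr fun w => tsum_congr fun y => ?_
          rw [hΦΦ₀]
      _ = ∑' wy : Site (d + 1) × Site (d + 1), Φ (wy.2, wy.1) xz := (hwy.tsum_prod).symm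
      _ = ∑' yw : Site (d + 1) × Site (d + 1), Φ yw xz :=
          (Equiv.prodComm (Site (d + 1)) (Site (d + 1))).tsum_eq (fun yw : Site (d + 1) × Site (d + 1) => Φ yw xz)
  -- (D) assemble
  have hF : Summable fun xz : Site (d + 1) × Site (d + 1) => ∑' yw : Site (d + 1) × Site (d + 1), Φ yw xz := hΦs.prod_symm.prod
  have hval : ∑' xz : Site (d + 1) × Site (d + 1), ∑' yw : Site (d + 1) × Site (d + 1), Φ yw xz
      = ∑' yw : Site (d + 1) × Site (d + 1), ∑ f, ∑ g, ρL f yw.1 * V yw.1 yw.2 f g * ρR g yw.2 := by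
    rw [hΦs.tsum_comm]
    exact tsum_congr fun yw => (hΦin yw).tsum_eq
  have h := hF.hasSum
  rw [hval] at h
  exact h.congr_fun fun xz => hpoint xz

/-! ## §2 The exchange tree and an2's `K3OfK` read at weighted coarse legs -/

/-- [folklore] **THE EXCHANGE READ-OUT, WEIGHTED COARSE LEGS**: the `mm`-entries of the exchange tree `K∘P∘K∘Q∘K` at the coarse points against `φ ⊗ ψ` have the
double-leg `HasSum` `Σ'_{(y,w)} Σ_{f,g} ρL f y · ((P∘K)∘Q) y w f g · ρR g w`. -/
theorem hasSum_exchange_readout_weight {K P Q : MKer (d + 1) (Fib d)} {C δ : ℝ} (hK : Decays K C δ) (hδ : 0 < δ) (hP : Loc P) (hQ : Loc Q)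
    (α β : Fin (d + 1)) {φ ψ : Site (d + 1) → ℝ} {Bφ Bψ : ℝ} (hφ : ∀ x', |φ x'| ≤ Bφ) (hψ : ∀ z', |ψ z'| ≤ Bψ) {ρL ρR : Fib d → Site (d + 1) → ℝ}
    (hrow : ∀ f y, HasSum (fun x' : Site (d + 1) => φ x' * K ((N : ℤ) • x') y (Sum.inr α) f) (ρL f y))
    (hcol : ∀ g w, HasSum (fun z' : Site (d + 1) => ψ z' * K w ((N : ℤ) • z') g (Sum.inr β)) (ρR g w)) :
    HasSum (fun xz : Site (d + 1) × Site (d + 1) =>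
        φ xz.1 * ψ xz.2 * comp (comp K P) (comp (comp K Q) K) ((N : ℤ) • xz.1) ((N : ℤ) • xz.2) (Sum.inr α) (Sum.inr β))
      (∑' yw : Site (d + 1) × Site (d + 1), ∑ f, ∑ g, ρL f yw.1 * comp (comp P K) Q yw.1 yw.2 f g * ρR g yw.2) := by
  have hKs : Spr K := ⟨C, δ, hδ, hK⟩
  obtain ⟨p, q, Cv, δv, hδv, hV⟩ := (hP.comp_spr hKs).comp hQ
  rw [exchange_eq_sandwich hKs hP hQ]
  exact hasSum_sandwich_readout_weight hK hδ hV hδv α β hφ hψ hrow hcol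

/-- [folklore] **THE READ-OUT OF `K3OfK`, WEIGHTED COARSE LEGS**: with `R[V] := Σ'_{(y,w)} Σ_{f,g} ρL f y · V y w f g · ρR g w`, the field–field block of
`mmRead N (K3OfK K N S M W μ y ν y′)` against the leg weights `φ ⊗ ψ` has the double-leg `HasSum` `R[(dM_b∘K)∘dM_{b′}] + R[(dM_{b′}∘K)∘dM_b] − R[W_{bb′}]`. -/
theorem hasSum_mmRead_K3OfK_weight {K : MKer (d + 1) (Fib d)} {C δ : ℝ} (hK : Decays K C δ) (hδ : 0 < δ)
    {S M : Fin (d + 1) → Site (d + 1) → MKer (d + 1) (Fib d)}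
    {W : Fin (d + 1) → Site (d + 1) → Fin (d + 1) → Site (d + 1) → MKer (d + 1) (Fib d)} {μ ν : Fin (d + 1)} {y y' : Site (d + 1)}
    (hb : Loc (dM K N S M μ y)) (hb' : Loc (dM K N S M ν y')) (hW : Loc (W μ y ν y')) (α β : Fin (d + 1))
    {φ ψ : Site (d + 1) → ℝ} {Bφ Bψ : ℝ} (hφ : ∀ x', |φ x'| ≤ Bφ) (hψ : ∀ z', |ψ z'| ≤ Bψ) {ρL ρR : Fib d → Site (d + 1) → ℝ}
    (hrow : ∀ f w, HasSum (fun x' : Site (d + 1) => φ x' * K ((N : ℤ) • x') w (Sum.inr α) f) (ρL f w))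
    (hcol : ∀ g w, HasSum (fun z' : Site (d + 1) => ψ z' * K w ((N : ℤ) • z') g (Sum.inr β)) (ρR g w)) :
    HasSum (fun xz : Site (d + 1) × Site (d + 1) => φ xz.1 * ψ xz.2 * mmRead N (K3OfK K N S M W μ y ν y') xz.1 xz.2 (Sum.inl α) (Sum.inl β))
      ((∑' yw : Site (d + 1) × Site (d + 1), ∑ f, ∑ g,
          ρL f yw.1 * comp (comp (dM K N S M μ y) K) (dM K N S M ν y') yw.1 yw.2 f g * ρR g yw.2) +
        (∑' yw : Site (d + 1) × Site (d + 1), ∑ f, ∑ g,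
          ρL f yw.1 * comp (comp (dM K N S M ν y') K) (dM K N S M μ y) yw.1 yw.2 f g * ρR g yw.2) -
        ∑' yw : Site (d + 1) × Site (d + 1), ∑ f, ∑ g, ρL f yw.1 * W μ y ν y' yw.1 yw.2 f g * ρR g yw.2) := by
  obtain ⟨p, q, Cw, δw, hδw, hWb⟩ := hW
  have h1 := hasSum_exchange_readout_weight (N := N) hK hδ hb hb' α β hφ hψ hrow hcol
  have h2 := hasSum_exchange_readout_weight (N := N) hK hδ hb' hb α β hφ hψ hrow hcol
  have h3 := hasSum_sandwich_readout_weight (N := N) hK hδ hWb hδw α β hφ hψ hrow hcol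
  refine ((h1.add h2).sub h3).congr_fun fun xz => ?_
  rw [mmRead_inl_inl, K3OfK_apply_eq]
  ring

end Summit.QuantumFields.BalabanUV.Beta.GAN24.SandwichReadoutWeighted

end
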